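import Summits.HubbardSuperconductivity.HubbardSuperconductivity.Theorems.AnisotropyChordTransferFibre3RowDLoopKit

/-!
# Route `AnisotropyChord` / H0 rotor rung, row D (KT-2a) Stage-1b: FAMILY BOUNDS for the loop sums of typed slots

Stage-1b of the row-D program (p1 g29 memo ROWD-DESIGN-g29 §5–§6, p1 g30).  The loop halves of the row-D coefficients are torus sums
`Σ_p R_ψ₃(p)·R_ψ₁(k₂+p)·R_ψ₂(k₃−p)` (`RowD.tconv_loop_eq`) resp. `Σ_p R_ψ₁(p)R_ψ₂(q−p)` of the `V`-less regular slot factors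
`R_ψ(q) = (u + u′e^{−iq·e})(β + γg(q))` of TYPED specs (`psiU kind u u′ e`: `J ↦ (β,γ) = (−a,0)`, `S ↦ (0,−c_s)`; weights
`(1,0)` plain, `(1,−1)` gradient `D_e`, `(0,1)` shift).  THIS FILE bounds their norms by the NAMED quantities
`S₁ = Σg`, `S₂ = Σg²`, `g_max = 1/(2ε₁−λ₂)`, `V`, the zone constant `c_Z(ν)` (`…RowDLoopKit`) and `a`, `c_s`:
* legs are the affine reparametrisations `affine σ c` (`p ↦ c ± p`, `…RowDLoopKit`); slot norms ★ `norm_rfacU_J/S` per weight type;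
* generic families (nonneg): ★ `fam_gww` (`Σ g·(wg)·(wg) ≤ c_Z S₂`), `fam_ggg` (`≤ g_max S₂`), `fam_ww` (`Σ(wg)(wg) ≤ c_Z S₁`),
  `fam_gw` (`≤ √(c_Z S₂ S₁)`), `fam_gg` (`≤ S₂`), `fam_w` (`≤ √(c_Z S₁ V)`), `fam_g` (`= S₁`);
(The typed three-slot tables `bnd3`/`bndM` and ★ `norm_loop3w_le`/`norm_loop3u_le` are the sibling `…RowDLoopTables`.)
Prover seat `hubbard-h0-rotor-p1` g30 (route lead); helper for piece A = stmt-HubbardSuperconductivity-23918 of rung 19089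
(`--supports`, helper class).  Nothing here proves superconductivity in the Hubbard model; lemmas for ONE row of ONE conditional reduction;
the rotor TARGET as originally worded stays FALSE (g15 verdict).  Tree imports only; no sorry.
-/

set_option linter.dupNamespace false
set_option autoImplicit false

open scoped BigOperators

namespace Summit.HubbardSuperconductivity.HubbardSuperconductivity.Theorems.AnisotropyChord.Transfer.Fibre3

namespace RowD

open RowC L2.N1

variable (L : ℕ) [NeZero L]

/-! ## Legs -/

omit [NeZero L] in
/-- `affine false c p = c + p`. [folklore] -/
theorem affine_false (c p : Tor L) : affine L false c p = c + p := rfl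

omit [NeZero L] in
/-- `affine true c p = c − p`. [folklore] -/
theorem affine_true (c p : Tor L) : affine L true c p = c - p := rfl

/-! ## Norms of the typed regular factors -/

section norms
variable (Δ lam2 : ℝ) (f : Tor L → ℝ)

/-- the gradient-weight norm `w_e(q) = ‖1 − conj(phase q e)‖`. -/
noncomputable def wnorm (q e : Tor L) : ℝ := ‖(1 : ℂ) - (starRingEnd ℂ) (phase L q e)‖

omit [NeZero L] in
/-- `w ≥ 0`. [folklore] -/
theorem wnorm_nonneg (q e : Tor L) : 0 ≤ wnorm L q e := norm_nonneg _

omit [NeZero L] in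
/-- ★ `J` slot: `‖R_(psiU J u u′ e)(q)‖ = ‖u + u′ conj(phase q e)‖ · a` (`a = Δf(x̂) ≥ 0`). [folklore] -/
theorem norm_rfacU_J (ha : 0 ≤ Δ * f (K1 L)) (u u' : ℝ) (e q : Tor L) :
    ‖RfacU L lam2 (psiU L Δ lam2 f false u u' e) q‖
      = ‖((u : ℝ) : ℂ) + ((u' : ℝ) : ℂ) * (starRingEnd ℂ) (phase L q e)‖ * (Δ * f (K1 L)) := by
  unfold RfacU psiU
  simp only [Bool.false_eq_true, if_false]
  rw [norm_mul, Complex.norm_real, Real.norm_eq_abs,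
    show -(Δ * f (K1 L)) + 0 * gres L lam2 q = -(Δ * f (K1 L)) by ring, abs_neg, abs_of_nonneg ha]

omit [NeZero L] in
/-- ★ `S` slot: `‖R_(psiU S u u′ e)(q)‖ = ‖u + u′ conj(phase q e)‖ · c_s g(q)` (`c_s, g ≥ 0`). [folklore] -/
theorem norm_rfacU_S (hcs : 0 ≤ cS L Δ lam2 f) (u u' : ℝ) (e q : Tor L) (hg : 0 ≤ gres L lam2 q) :
    ‖RfacU L lam2 (psiU L Δ lam2 f true u u' e) q‖
      = ‖((u : ℝ) : ℂ) + ((u' : ℝ) : ℂ) * (starRingEnd ℂ) (phase L q e)‖ * (cS L Δ lam2 f * gres L lam2 q) := by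
  unfold RfacU psiU
  simp only [if_true]
  rw [norm_mul, Complex.norm_real, Real.norm_eq_abs,
    show (0 : ℝ) + -cS L Δ lam2 f * gres L lam2 q = -(cS L Δ lam2 f * gres L lam2 q) by ring, abs_neg,
    abs_of_nonneg (mul_nonneg hcs hg)]

omit [NeZero L] in
/-- plain weight `(1,0)`: norm `1`. [folklore] -/
theorem wfac_plain (z : ℂ) : ‖(((1 : ℝ) : ℝ) : ℂ) + (((0 : ℝ) : ℝ) : ℂ) * z‖ = 1 := by simp

omit [NeZero L] in
/-- gradient weight `(1,−1)`: norm `w_e(q)`. [folklore] -/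
theorem wfac_grad (q e : Tor L) :
    ‖(((1 : ℝ) : ℝ) : ℂ) + (((-1 : ℝ) : ℝ) : ℂ) * (starRingEnd ℂ) (phase L q e)‖ = wnorm L q e := by
  unfold wnorm; push_cast; ring_nf

/-- shift weight `(0,1)`: norm `1`. [folklore] -/
theorem wfac_shift (q e : Tor L) :
    ‖(((0 : ℝ) : ℝ) : ℂ) + (((1 : ℝ) : ℝ) : ℂ) * (starRingEnd ℂ) (phase L q e)‖ = 1 := by
  push_cast; rw [zero_add, one_mul, Complex.norm_conj, norm_phase]

end norms

/-! ## Generic families of nonnegative torus sums -/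

section fam
variable (lam2 : ℝ)

/-- `λ₂ = (λ₂/θ²)·θ²`. [folklore] -/
theorem lam2_eq_nu_mul : lam2 = lam2 / (2 * Real.pi / L) ^ 2 * (2 * Real.pi / L) ^ 2 := by
  have hL : (0 : ℝ) < L := by exact_mod_cast Nat.pos_of_ne_zero (NeZero.ne L)
  have : (2 * Real.pi / L : ℝ) ^ 2 ≠ 0 := by positivity
  field_simp

variable {lam2}

/-- `g ≥ 0` in the regime `ν < 4/π²`. [folklore] -/
theorem g_nonneg (hν : lam2 / (2 * Real.pi / L) ^ 2 < 4 / Real.pi ^ 2) (q : Tor L) : 0 ≤ gres L lam2 q := by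
  rw [lam2_eq_nu_mul L lam2]; exact B1.gres_nonneg L _ hν q

/-- `(w_e(q) g(q))² ≤ c_Z g(q)` in the regime (`e ∈ E4`). [folklore] -/
theorem wg_sq_le (hν0 : 0 ≤ lam2 / (2 * Real.pi / L) ^ 2) (hν : lam2 / (2 * Real.pi / L) ^ 2 < 4 / Real.pi ^ 2) (q : Tor L) {e : ℤ × ℤ} (he : e ∈ E4) :
    (wnorm L q (B1.toTor L e) * gres L lam2 q) ^ 2 ≤ cZ (lam2 / (2 * Real.pi / L) ^ 2) * gres L lam2 q := by
  have := wt_gres_sq_le L (lam2 / (2 * Real.pi / L) ^ 2) hν0 hν q he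
  rw [← lam2_eq_nu_mul L lam2] at this
  exact this

omit [NeZero L] in
/-- `c_Z ≥ 0` in the regime. [folklore] -/
theorem cZ_nonneg (hν : lam2 / (2 * Real.pi / L) ^ 2 < 4 / Real.pi ^ 2) : 0 ≤ cZ (lam2 / (2 * Real.pi / L) ^ 2) :=
  (cZ_pos hν).le

/-- `S₂ ≥ 0`. [folklore] -/
theorem S2n_nonneg (lam2 : ℝ) : 0 ≤ S2n L lam2 := by
  rw [S2n_eq]; exact Finset.sum_nonneg fun _ _ => sq_nonneg _

/-- `S₁ ≥ 0` in the regime. [folklore] -/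
theorem S1n_nonneg (hν : lam2 / (2 * Real.pi / L) ^ 2 < 4 / Real.pi ^ 2) : 0 ≤ S1n L lam2 := by
  rw [S1n_eq]; exact Finset.sum_nonneg fun q _ => g_nonneg L hν q

/-- ★ family `{G, GW, GW}`: `Σ_p g(ℓ₀p)·(w g)(ℓ₁p)·(w g)(ℓ₂p) ≤ c_Z·S₂`. [folklore] -/
theorem fam_gww (hν0 : 0 ≤ lam2 / (2 * Real.pi / L) ^ 2) (hν : lam2 / (2 * Real.pi / L) ^ 2 < 4 / Real.pi ^ 2) (σ₀ : Bool) (c₀ : Tor L) (σ₁ : Bool) (c₁ : Tor L) (σ₂ : Bool) (c₂ : Tor L)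
    {e₁ e₂ : ℤ × ℤ} (he₁ : e₁ ∈ E4) (he₂ : e₂ ∈ E4) :
    ∑ p : Tor L, gres L lam2 (affine L σ₀ c₀ p) * (wnorm L (affine L σ₁ c₁ p) (B1.toTor L e₁) * gres L lam2 (affine L σ₁ c₁ p))
        * (wnorm L (affine L σ₂ c₂ p) (B1.toTor L e₂) * gres L lam2 (affine L σ₂ c₂ p))
      ≤ cZ (lam2 / (2 * Real.pi / L) ^ 2) * S2n L lam2 :=
  sum_three_two_le (cZ_nonneg L hν) (S2n_nonneg L lam2)
    (fun _ => g_nonneg L hν _) (fun _ => g_nonneg L hν _) (fun _ => g_nonneg L hν _)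
    (fun _ => mul_nonneg (wnorm_nonneg L _ _) (g_nonneg L hν _))
    (fun _ => wg_sq_le L hν0 hν _ he₁) (fun _ => wg_sq_le L hν0 hν _ he₂)
    (sum_gres_sq_affine L lam2 σ₀ c₀).le (sum_gres_sq_affine L lam2 σ₁ c₁).le (sum_gres_sq_affine L lam2 σ₂ c₂).le

/-- ★ family `{G, G, G}`: `Σ g g g ≤ g_max·S₂` (`g ≤ g_max := 1/(2ε₁ − λ₂)`, `λ₂ < 2ε₁`). [folklore] -/
theorem fam_ggg (hL : 2 ≤ L) (hν : lam2 / (2 * Real.pi / L) ^ 2 < 4 / Real.pi ^ 2) (hlam : lam2 < 2 * eps1 L) (σ₀ : Bool) (c₀ : Tor L) (σ₁ : Bool) (c₁ : Tor L) (σ₂ : Bool) (c₂ : Tor L) :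
    ∑ p : Tor L, gres L lam2 (affine L σ₀ c₀ p) * gres L lam2 (affine L σ₁ c₁ p) * gres L lam2 (affine L σ₂ c₂ p) ≤ 1 / (2 * eps1 L - lam2) * S2n L lam2 :=
  sum_three_zero_le (by have : 0 < 2 * eps1 L - lam2 := by linarith
                        positivity) (S2n_nonneg L lam2)
    (fun _ => g_nonneg L hν _) (fun _ => g_nonneg L hν _) (fun _ => gres_le_gmax L hL hlam _)
    (sum_gres_sq_affine L lam2 σ₀ c₀).le (sum_gres_sq_affine L lam2 σ₁ c₁).le

/-- ★ family `{GW, GW}`: `Σ (w g)(ℓ₁p)(w g)(ℓ₂p) ≤ c_Z·S₁`. [folklore] -/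
theorem fam_ww (hν0 : 0 ≤ lam2 / (2 * Real.pi / L) ^ 2) (hν : lam2 / (2 * Real.pi / L) ^ 2 < 4 / Real.pi ^ 2) (σ₁ : Bool) (c₁ : Tor L) (σ₂ : Bool) (c₂ : Tor L)
    {e₁ e₂ : ℤ × ℤ} (he₁ : e₁ ∈ E4) (he₂ : e₂ ∈ E4) :
    ∑ p : Tor L, (wnorm L (affine L σ₁ c₁ p) (B1.toTor L e₁) * gres L lam2 (affine L σ₁ c₁ p)) * (wnorm L (affine L σ₂ c₂ p) (B1.toTor L e₂) * gres L lam2 (affine L σ₂ c₂ p))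
      ≤ cZ (lam2 / (2 * Real.pi / L) ^ 2) * S1n L lam2 :=
  sum_two_wt_le (cZ_nonneg L hν) (S1n_nonneg L hν)
    (fun _ => g_nonneg L hν _) (fun _ => g_nonneg L hν _)
    (fun _ => mul_nonneg (wnorm_nonneg L _ _) (g_nonneg L hν _))
    (fun _ => wg_sq_le L hν0 hν _ he₁) (fun _ => wg_sq_le L hν0 hν _ he₂)
    (sum_gres_affine L lam2 σ₁ c₁).le (sum_gres_affine L lam2 σ₂ c₂).le

/-- ★ family `{G, GW}`: `Σ g(ℓ₁p)·(w g)(ℓ₂p) ≤ √(c_Z·S₂·S₁)`. [folklore] -/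
theorem fam_gw (hν0 : 0 ≤ lam2 / (2 * Real.pi / L) ^ 2) (hν : lam2 / (2 * Real.pi / L) ^ 2 < 4 / Real.pi ^ 2) (σ₁ : Bool) (c₁ : Tor L) (σ₂ : Bool) (c₂ : Tor L)
    {e₂ : ℤ × ℤ} (he₂ : e₂ ∈ E4) :
    ∑ p : Tor L, gres L lam2 (affine L σ₁ c₁ p) * (wnorm L (affine L σ₂ c₂ p) (B1.toTor L e₂) * gres L lam2 (affine L σ₂ c₂ p))
      ≤ Real.sqrt (cZ (lam2 / (2 * Real.pi / L) ^ 2) * S2n L lam2 * S1n L lam2) :=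
  sum_one_wt_le (cZ_nonneg L hν) (S2n_nonneg L lam2)
    (fun _ => g_nonneg L hν _) (fun _ => g_nonneg L hν _)
    (fun _ => wg_sq_le L hν0 hν _ he₂)
    (sum_gres_sq_affine L lam2 σ₁ c₁).le (sum_gres_sq_affine L lam2 σ₂ c₂).le (sum_gres_affine L lam2 σ₁ c₁).le

/-- ★ family `{G, G}`: `Σ g(ℓ₁p) g(ℓ₂p) ≤ S₂`. [folklore] -/
theorem fam_gg (σ₁ : Bool) (c₁ : Tor L) (σ₂ : Bool) (c₂ : Tor L) (lam2 : ℝ) :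
    ∑ p : Tor L, gres L lam2 (affine L σ₁ c₁ p) * gres L lam2 (affine L σ₂ c₂ p) ≤ S2n L lam2 :=
  sum_two_le (S2n_nonneg L lam2) (sum_gres_sq_affine L lam2 σ₁ c₁).le (sum_gres_sq_affine L lam2 σ₂ c₂).le

/-- ★ family `{GW}`: `Σ (w g)(ℓp) ≤ √(c_Z·S₁·V)`. [folklore] -/
theorem fam_w (hν0 : 0 ≤ lam2 / (2 * Real.pi / L) ^ 2) (hν : lam2 / (2 * Real.pi / L) ^ 2 < 4 / Real.pi ^ 2) (σ : Bool) (c : Tor L) {e : ℤ × ℤ} (he : e ∈ E4) :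
    ∑ p : Tor L, wnorm L (affine L σ c p) (B1.toTor L e) * gres L lam2 (affine L σ c p)
      ≤ Real.sqrt (cZ (lam2 / (2 * Real.pi / L) ^ 2) * S1n L lam2 * (L : ℝ) ^ 2) := by
  have hc : (Fintype.card (Tor L) : ℝ) = (L : ℝ) ^ 2 := by
    rw [Fintype.card_prod, ZMod.card]; push_cast; ring
  rw [← hc]
  exact sum_wt_le (cZ_nonneg L hν) (S1n_nonneg L hν) (fun _ => g_nonneg L hν _) (fun _ => wg_sq_le L hν0 hν _ he) (sum_gres_affine L lam2 σ c).le

/-- ★ family `{G}`: `Σ g(ℓp) = S₁`. [folklore] -/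
theorem fam_g (σ : Bool) (c : Tor L) (lam2 : ℝ) : ∑ p : Tor L, gres L lam2 (affine L σ c p) = S1n L lam2 :=
  sum_gres_affine L lam2 σ c

end fam


end RowD

end Summit.HubbardSuperconductivity.HubbardSuperconductivity.Theorems.AnisotropyChord.Transfer.Fibre3
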